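import Summits.SmoothPoincare4.SmoothPoincare4.Theorems.SymplecticOrigamiGromovRecognitionRelEndStubCapModelCap3

/-!
# Wedge cap for `GromovRecognitionRelEnd` — the cap `C = C₁ ∪ OC`: Hausdorff, complex, symplectic
(stub `stub_capModel` of line `cross-cap-laurent`, crux `SymplecticOrigami.GromovRecognitionRelEnd`,
item stmt-SmoothPoincare4-11009)

The cap `C = (OV ∪ OH) ∪ OC` (an open neighbourhood of the wedge `ℂP¹ ∨ ℂP¹ = {z₁ = ∞} ∪ {z₂ = ∞}`
in `ℂP¹ × ℂP¹`, glued from three affine charts) is Hausdorff: the graph of the corner gluing `glueC`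
is closed, because near a closure point `(y, c)` the corner coordinate `|t|²` (resp. `|u|²`) of glued
points is bounded below by the reciprocal of a bound for `|z₂|²` (resp. `|z₁|²`) near `y`, so `c` is
not the corner. The corner gluing is holomorphic for `J₁` and `i ⊕ i` (`hol_C`) and identifies the
cap forms (`compat_C`: `inv2^* ΩC = ΩV`, `inv1^* ΩC = ΩH`), whence the complex structure `JCap`
and the closed taming form `βCap` of the cap.
-/

noncomputable section

-- the registered namespace `Summit.SmoothPoincare4.SmoothPoincare4.Theorems…` repeats a component
set_option linter.dupNamespace false

open scoped Manifold ContDiff Topology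
open Set Function Filter TopologicalSpace Literature.Geometry.Kaehler Literature.Geometry.Symplectic
  Literature.Topology.FourManifolds

namespace Summit.SmoothPoincare4.SmoothPoincare4.Theorems.GromovRecognitionRelEnd.CrossCapLaurent

namespace CapModel

/-- Model space `ℝ⁴ = ℂ²` (coordinates `0,1` = `z₁`, `2,3` = `z₂`). -/
local notation "E4" => EuclideanSpace ℝ (Fin 4)

/-! ## The mirrored closed-graph criterion -/

/-- **Closed-graph criterion, target form**: the graph of a partial homeomorphism from a Hausdorff
space is closed as soon as its closure projects into the target. [folklore] -/
theorem isClosed_graph_of_closure_subset_target {A B : Type*} [TopologicalSpace A]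
    [TopologicalSpace B] [T2Space A] (e : OpenPartialHomeomorph A B)
    (h : ∀ p ∈ closure {p : A × B | p.1 ∈ e.source ∧ e p.1 = p.2}, p.2 ∈ e.target) :
    IsClosed {p : A × B | p.1 ∈ e.source ∧ e p.1 = p.2} := by
  have hG : {p : A × B | p.1 ∈ e.source ∧ e p.1 = p.2} =
      Prod.swap ⁻¹' {q : B × A | q.1 ∈ e.symm.source ∧ e.symm q.1 = q.2} := by
    ext ⟨a, b⟩
    simp only [mem_setOf_eq, mem_preimage, Prod.swap_prod_mk, OpenPartialHomeomorph.symm_source]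
    constructor
    · rintro ⟨ha, rfl⟩; exact ⟨e.map_source ha, e.left_inv ha⟩
    · rintro ⟨hb, rfl⟩; exact ⟨e.map_target hb, e.right_inv hb⟩
  rw [hG]
  refine IsClosed.preimage continuous_swap (isClosed_graph_of_closure_subset e.symm ?_)
  intro q hq
  have hq' : q.swap ∈ closure {p : A × B | p.1 ∈ e.source ∧ e p.1 = p.2} := by
    rw [hG, show (Prod.swap ⁻¹' {q : B × A | q.1 ∈ e.symm.source ∧ e.symm q.1 = q.2}) =
      (Homeomorph.prodComm A B) ⁻¹' {q : B × A | q.1 ∈ e.symm.source ∧ e.symm q.1 = q.2} from rfl,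
      ← Homeomorph.preimage_closure]
    simpa using hq
  exact h _ hq'

variable {R₁ : ℝ} [hR : Fact (0 < R₁)]

/-- `instance`: `C₁` is nonempty. [folklore] -/
instance : Nonempty (C₁ R₁) := ⟨jV₁ oV⟩

/-! ## The gluing region seen from the charts -/

/-- `jV₁ b` is in the gluing region of the corner iff `R₁² < |z₂|²`. [folklore] -/
theorem jV₁_mem_source_iff {b : OV R₁} :
    (jV₁ b : C₁ R₁) ∈ (dC1 R₁).glue.source ↔ R₁ ^ 2 < r2 b.1 := by
  rw [dC1_glue, glueC_source]
  constructor
  · rintro (⟨b', hb', h⟩ | ⟨b', hb', h⟩)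
    · rwa [← (dVH R₁).inl_injective h]
    · exact (jV₁_eq_jH₁_iff.1 h.symm).1.2
  · exact fun h => Or.inl ⟨b, h, rfl⟩

/-- `jH₁ b` is in the gluing region of the corner iff `R₁² < |z₁|²`. [folklore] -/
theorem jH₁_mem_source_iff {b : OH R₁} :
    (jH₁ b : C₁ R₁) ∈ (dC1 R₁).glue.source ↔ R₁ ^ 2 < r1 b.1 := by
  rw [dC1_glue, glueC_source]
  constructor
  · rintro (⟨b', hb', h⟩ | ⟨b', hb', h⟩)
    · obtain ⟨⟨h1, h2⟩, hbb⟩ := jV₁_eq_jH₁_iff.1 h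
      rw [← hbb, mkH, val_toOpens (inv12_mapsV b'.2 h1 h2).1]
      exact (inv12_mapsV b'.2 h1 h2).2.2
    · rwa [← (dVH R₁).inr_injective h]
  · exact fun h => Or.inr ⟨b, h, rfl⟩

omit hR in
/-- `|z₂|²` is bounded on a unit ball: `r2 b ≤ (‖b₀‖ + 1)²` when `‖b - b₀‖ < 1`. [folklore] -/
theorem r2_le_of_norm_sub_lt {b b₀ : E4} (h : ‖b - b₀‖ < 1) : r2 b ≤ (‖b₀‖ + 1) ^ 2 := by
  have hb : ‖b‖ ≤ ‖b₀‖ + 1 := by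
    have := norm_le_norm_add_norm_sub' b b₀
    have := norm_sub_rev b b₀
    linarith [norm_add_le b₀ (b - b₀), show b = b₀ + (b - b₀) by abel]
  exact (r2_le_norm_sq b).trans (pow_le_pow_left₀ (norm_nonneg b) hb 2)

omit hR in
/-- `|z₁|²` is bounded on a unit ball. [folklore] -/
theorem r1_le_of_norm_sub_lt {b b₀ : E4} (h : ‖b - b₀‖ < 1) : r1 b ≤ (‖b₀‖ + 1) ^ 2 := by
  have hb : ‖b‖ ≤ ‖b₀‖ + 1 := by
    have := norm_le_norm_add_norm_sub' b b₀
    have := norm_sub_rev b b₀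
    linarith [norm_add_le b₀ (b - b₀), show b = b₀ + (b - b₀) by abel]
  exact (r1_le_norm_sq b).trans (pow_le_pow_left₀ (norm_nonneg b) hb 2)

/-! ## The cap is Hausdorff -/

/-- **The graph of the corner gluing is closed.** [folklore] -/
theorem isClosed_graph_glueC :
    IsClosed {p : C₁ R₁ × OC R₁ | p.1 ∈ (dC1 R₁).glue.source ∧ (dC1 R₁).glue p.1 = p.2} := by
  apply isClosed_graph_of_closure_subset_target
  rintro ⟨y, c⟩ hp
  rw [dC1_glue, glueC_target]
  by_contra hc
  simp only [mem_setOf_eq, not_or, not_not] at hc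
  rcases (dVH R₁).exists_inl_or_inr y with ⟨b₀, rfl⟩ | ⟨b₀, rfl⟩
  · -- near a point of the `V`-chart, glued points have `|t|² = |z₂|⁻²` bounded below
    set M : ℝ := (‖b₀.1‖ + 1) ^ 2 with hM
    have hMpos : 0 < M := by positivity
    have hN : jV₁ '' {b : OV R₁ | ‖b.1 - b₀.1‖ < 1} ∈ 𝓝 (jV₁ b₀ : C₁ R₁) :=
      ((dVH R₁).isOpenMap_inl _ ((Metric.isOpen_ball (x := b₀.1) (ε := 1)).preimage
        (by fun_prop : Continuous fun b : OV R₁ => b.1))).mem_nhds ⟨b₀, by simp, rfl⟩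
    have hW : {c' : OC R₁ | r2 c'.1 < M⁻¹} ∈ 𝓝 c :=
      ((isOpen_lt continuous_r2 continuous_const).preimage continuous_subtype_val).mem_nhds
        (by show r2 c.1 < M⁻¹; rw [hc.2]; positivity)
    have hNW := prod_mem_nhds hN hW
    obtain ⟨⟨y, c'⟩, ⟨⟨b, hb, rfl⟩, hc'⟩, hy, hyc⟩ := mem_closure_iff_nhds.1 hp _ hNW
    dsimp only at hy hyc hc'
    have h2 : R₁ ^ 2 < r2 b.1 := jV₁_mem_source_iff.1 hy
    have hc'' : c' = mkC (inv2 b.1) := by rw [← hyc, dC1_glue, glueC_apply, gC_jV₁]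
    have hval : c'.1 = inv2 b.1 := by rw [hc'', mkC, val_toOpens (inv2_mapsV b.2 h2).1]
    have hlt : r2 c'.1 < M⁻¹ := hc'
    rw [hval, r2_inv2] at hlt
    have hle : r2 b.1 ≤ M := r2_le_of_norm_sub_lt hb
    have hpos : 0 < r2 b.1 := lt_of_le_of_lt (sq_nonneg _) h2
    exact absurd (inv_anti₀ hpos hle) (not_le.2 hlt)
  · set M : ℝ := (‖b₀.1‖ + 1) ^ 2 with hM
    have hMpos : 0 < M := by positivity
    have hN : jH₁ '' {b : OH R₁ | ‖b.1 - b₀.1‖ < 1} ∈ 𝓝 (jH₁ b₀ : C₁ R₁) :=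
      ((dVH R₁).isOpenMap_inr _ ((Metric.isOpen_ball (x := b₀.1) (ε := 1)).preimage
        (by fun_prop : Continuous fun b : OH R₁ => b.1))).mem_nhds ⟨b₀, by simp, rfl⟩
    have hW : {c' : OC R₁ | r1 c'.1 < M⁻¹} ∈ 𝓝 c :=
      ((isOpen_lt continuous_r1 continuous_const).preimage continuous_subtype_val).mem_nhds
        (by show r1 c.1 < M⁻¹; rw [hc.1]; positivity)
    have hNW := prod_mem_nhds hN hW
    obtain ⟨⟨y, c'⟩, ⟨⟨b, hb, rfl⟩, hc'⟩, hy, hyc⟩ := mem_closure_iff_nhds.1 hp _ hNW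
    dsimp only at hy hyc hc'
    have h1 : R₁ ^ 2 < r1 b.1 := jH₁_mem_source_iff.1 hy
    have hc'' : c' = mkC (inv1 b.1) := by rw [← hyc, dC1_glue, glueC_apply, gC_jH₁]
    have hval : c'.1 = inv1 b.1 := by rw [hc'', mkC, val_toOpens (inv1_mapsH b.2 h1).1]
    have hlt : r1 c'.1 < M⁻¹ := hc'
    rw [hval, r1_inv1] at hlt
    have hle : r1 b.1 ≤ M := r1_le_of_norm_sub_lt hb
    have hpos : 0 < r1 b.1 := lt_of_le_of_lt (sq_nonneg _) h1
    exact absurd (inv_anti₀ hpos hle) (not_le.2 hlt)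

/-- `instance`: the cap `C` is Hausdorff. [folklore] -/
instance : T2Space (dC1 R₁).Glued := (dC1 R₁).t2Space_of_isClosed_graph isClosed_graph_glueC

/-! ## Holomorphy and consistency of the corner gluing -/

/-- On the `V`-chart, `glueC ∘ jV₁ = mkC ∘ inv2 ∘ val`. [folklore] -/
theorem glueC_comp_jV₁ : ((dC1 R₁).glue : C₁ R₁ → OC R₁) ∘ jV₁ = toOpens (OC R₁) oC ∘ inv2 ∘ Subtype.val := by
  funext b; exact gC_jV₁ b

/-- On the `H`-chart, `glueC ∘ jH₁ = mkC ∘ inv1 ∘ val`. [folklore] -/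
theorem glueC_comp_jH₁ : ((dC1 R₁).glue : C₁ R₁ → OC R₁) ∘ jH₁ = toOpens (OC R₁) oC ∘ inv1 ∘ Subtype.val := by
  funext b; exact gC_jH₁ b

/-- The differential of `glueC` on push-forwards from the `V`-chart. [folklore] -/
theorem mfderiv_glueC_jV₁ {b : OV R₁} (h2 : R₁ ^ 2 < r2 b.1) (u : E4) :
    mfderiv 𝓘(ℝ, E4) 𝓘(ℝ, E4) (dC1 R₁).glue (jV₁ b) (mfderiv 𝓘(ℝ, E4) 𝓘(ℝ, E4) jV₁ b u) =
      fderiv ℝ inv2 b.1 u := by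
  have hg : MDifferentiableAt 𝓘(ℝ, E4) 𝓘(ℝ, E4) (dC1 R₁).glue (jV₁ b) :=
    (contMDiffAt_gC_V h2).mdifferentiableAt (by simp)
  have hf : MDifferentiableAt 𝓘(ℝ, E4) 𝓘(ℝ, E4) (jV₁ : OV R₁ → C₁ R₁) b :=
    ((dVH R₁).contMDiff_inl b).mdifferentiableAt (by simp)
  have h1 : mfderiv 𝓘(ℝ, E4) 𝓘(ℝ, E4) (((dC1 R₁).glue : C₁ R₁ → OC R₁) ∘ jV₁) b u =
      fderiv ℝ inv2 b.1 u := by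
    rw [glueC_comp_jV₁, mfderiv_pieceMap (contDiffAt_inv2 (r2_ne_zero_of_sq_lt h2)) (inv2_mapsV b.2 h2).1]
  exact (congrArg (fun L : E4 →L[ℝ] E4 => L u) (mfderiv_comp b hg hf)).symm.trans h1

/-- The differential of `glueC` on push-forwards from the `H`-chart. [folklore] -/
theorem mfderiv_glueC_jH₁ {b : OH R₁} (h1 : R₁ ^ 2 < r1 b.1) (u : E4) :
    mfderiv 𝓘(ℝ, E4) 𝓘(ℝ, E4) (dC1 R₁).glue (jH₁ b) (mfderiv 𝓘(ℝ, E4) 𝓘(ℝ, E4) jH₁ b u) =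
      fderiv ℝ inv1 b.1 u := by
  have hg : MDifferentiableAt 𝓘(ℝ, E4) 𝓘(ℝ, E4) (dC1 R₁).glue (jH₁ b) :=
    (contMDiffAt_gC_H h1).mdifferentiableAt (by simp)
  have hf : MDifferentiableAt 𝓘(ℝ, E4) 𝓘(ℝ, E4) (jH₁ : OH R₁ → C₁ R₁) b :=
    ((dVH R₁).contMDiff_inr b).mdifferentiableAt (by simp)
  have h1' : mfderiv 𝓘(ℝ, E4) 𝓘(ℝ, E4) (((dC1 R₁).glue : C₁ R₁ → OC R₁) ∘ jH₁) b u =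
      fderiv ℝ inv1 b.1 u := by
    rw [glueC_comp_jH₁, mfderiv_pieceMap (contDiffAt_inv1 (r1_ne_zero_of_sq_lt h1)) (inv1_mapsH b.2 h1).1]
  exact (congrArg (fun L : E4 →L[ℝ] E4 => L u) (mfderiv_comp b hg hf)).symm.trans h1'

/-- **The corner gluing is `(J₁, i ⊕ i)`-holomorphic.** [folklore] -/
theorem hol_C : ∀ y ∈ (dC1 R₁).glue.source, ∀ w : E4,
    mfderiv 𝓘(ℝ, E4) 𝓘(ℝ, E4) (dC1 R₁).glue y (J₁ R₁ y w) =
      JC R₁ ((dC1 R₁).glue y) (mfderiv 𝓘(ℝ, E4) 𝓘(ℝ, E4) (dC1 R₁).glue y w) := by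
  intro y hy w
  rcases (dVH R₁).exists_inl_or_inr y with ⟨b, rfl⟩ | ⟨b, rfl⟩
  · have h2 := jV₁_mem_source_iff.1 hy
    obtain ⟨u, rfl⟩ := mfderiv_surjective (dVH R₁).isSmoothEmbedding_inl (dVH R₁).isOpen_range_inl b w
    rw [J₁, GlueJ.glueACS_inl, JC_apply, mfderiv_glueC_jV₁ h2, mfderiv_glueC_jV₁ h2, JV_apply,
      fderiv_inv2_I4 (r2_ne_zero_of_sq_lt h2)]
  · have h1 := jH₁_mem_source_iff.1 hy
    obtain ⟨u, rfl⟩ := mfderiv_surjective (dVH R₁).isSmoothEmbedding_inr (dVH R₁).isOpen_range_inr b w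
    rw [J₁, GlueJ.glueACS_inr, JC_apply, mfderiv_glueC_jH₁ h1, mfderiv_glueC_jH₁ h1, JH_apply,
      fderiv_inv1_I4 (r1_ne_zero_of_sq_lt h1)]

omit hR in
/-- Pointwise chain rule for pull-backs (general manifolds modelled on `ℝ⁴`). [folklore] -/
theorem pullback_comp_pt {M N P : Type*} [TopologicalSpace M] [ChartedSpace E4 M]
    [TopologicalSpace N] [ChartedSpace E4 N] [TopologicalSpace P] [ChartedSpace E4 P]
    (γ : MForm 𝓘(ℝ, E4) P ℝ 2) {g : N → P} {f : M → N} {x : M}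
    (hg : MDifferentiableAt 𝓘(ℝ, E4) 𝓘(ℝ, E4) g (f x)) (hf : MDifferentiableAt 𝓘(ℝ, E4) 𝓘(ℝ, E4) f x) :
    γ.pullback 𝓘(ℝ, E4) (g ∘ f) x = (γ.pullback 𝓘(ℝ, E4) g).pullback 𝓘(ℝ, E4) f x := by
  ext u
  simp only [MForm.pullback_apply, Function.comp_apply, mfderiv_comp x hg hf]
  rfl

/-- **`glueC^* βC = β₁` on the gluing region.** [folklore] -/
theorem compat_C : ∀ y ∈ (dC1 R₁).glue.source, (βC R₁).pullback 𝓘(ℝ, E4) (dC1 R₁).glue y = β₁ R₁ y := by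
  intro y hy
  rcases (dVH R₁).exists_inl_or_inr y with ⟨b, rfl⟩ | ⟨b, rfl⟩
  · have h2 := jV₁_mem_source_iff.1 hy
    have h2' : r2 b.1 ≠ 0 := r2_ne_zero_of_sq_lt h2
    refine MForm.eq_of_pullback_eq (mfderiv_surjective (dVH R₁).isSmoothEmbedding_inl
      (dVH R₁).isOpen_range_inl b) ?_
    have hg : MDifferentiableAt 𝓘(ℝ, E4) 𝓘(ℝ, E4) (dC1 R₁).glue (jV₁ b) :=
      (contMDiffAt_gC_V h2).mdifferentiableAt (by simp)
    have hf : MDifferentiableAt 𝓘(ℝ, E4) 𝓘(ℝ, E4) (jV₁ : OV R₁ → C₁ R₁) b :=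
      ((dVH R₁).contMDiff_inl b).mdifferentiableAt (by simp)
    rw [β₁, GlueF.glueForm_pullback_inl, ← pullback_comp_pt _ hg hf, glueC_comp_jV₁, βC,
      pullback_pieceMap (contDiffAt_inv2 h2') (inv2_mapsV b.2 h2).1, ΩC_pullback_inv2 R₁ h2', βV]
    ext u
    exact (MForm.pullback_subtypeVal_apply (ΩV R₁) b u).symm
  · have h1 := jH₁_mem_source_iff.1 hy
    have h1' : r1 b.1 ≠ 0 := r1_ne_zero_of_sq_lt h1
    refine MForm.eq_of_pullback_eq (mfderiv_surjective (dVH R₁).isSmoothEmbedding_inr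
      (dVH R₁).isOpen_range_inr b) ?_
    have hg : MDifferentiableAt 𝓘(ℝ, E4) 𝓘(ℝ, E4) (dC1 R₁).glue (jH₁ b) :=
      (contMDiffAt_gC_H h1).mdifferentiableAt (by simp)
    have hf : MDifferentiableAt 𝓘(ℝ, E4) 𝓘(ℝ, E4) (jH₁ : OH R₁ → C₁ R₁) b :=
      ((dVH R₁).contMDiff_inr b).mdifferentiableAt (by simp)
    rw [β₁, GlueF.glueForm_pullback_inr _ compat_VH, ← pullback_comp_pt _ hg hf, glueC_comp_jH₁, βC,
      pullback_pieceMap (contDiffAt_inv1 h1') (inv1_mapsH b.2 h1).1, ΩC_pullback_inv1 R₁ h1', βH]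
    ext u
    exact (MForm.pullback_subtypeVal_apply (ΩH R₁) b u).symm

/-! ## The complex structure and the cap form of `C` -/

/-- Notation-free abbreviation: the cap `C = C₁ ∪ OC`. [folklore] -/
abbrev Cap (R₁ : ℝ) [Fact (0 < R₁)] : Type := (dC1 R₁).Glued

variable (R₁) in
/-- **The complex structure of the cap** (`= i ⊕ i` in all three charts). [folklore] -/
def JCap : AlmostComplexStructure 𝓘(ℝ, E4) ∞ (Cap R₁) := GlueJ.glueACS (dC1 R₁) (J₁ R₁) (JC R₁) hol_C

variable (R₁) in
/-- **The cap form** (`= ΩV, ΩH, ΩC` in the three charts). [folklore] -/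
def βCap : MForm 𝓘(ℝ, E4) (Cap R₁) ℝ 2 := GlueF.glueForm (dC1 R₁) (β₁ R₁) (βC R₁)

/-- The cap form is smooth, closed and tames the complex structure of the cap. [folklore] -/
theorem βCap_smooth_closed_tame :
    IsSmoothForm (βCap R₁) ∧ IsClosedForm (βCap R₁) ∧ (JCap R₁).IsTamedBy (βCap R₁) := by
  obtain ⟨h1s, h1c, h1t⟩ := β₁_smooth_closed_tame (R₁ := R₁)
  obtain ⟨-, -, hCs, hCc⟩ := βVHC_smooth_closed (R₁ := R₁)
  obtain ⟨-, -, hCt⟩ := βVHC_tame (R₁ := R₁)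
  exact ⟨GlueF.isSmoothForm_glueForm _ compat_C h1s hCs,
    GlueF.isClosedForm_glueForm _ compat_C h1s hCs h1c hCc,
    GlueF.glueForm_tames _ compat_C hol_C h1t hCt⟩

end CapModel

/-- **Registered helper sub-goal `helper_capModelClosedGraphTarget`** (file `Cap4` of stub
`stub_capModel`): closed-graph criterion, target form — the graph of a partial homeomorphism from
a Hausdorff space is closed once its closure projects into the target. [folklore] -/
theorem helper_capModelClosedGraphTarget : ∀ (A B : Type) [TopologicalSpace A] [TopologicalSpace B]
    [T2Space A] (e : OpenPartialHomeomorph A B),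
    (∀ p ∈ closure {p : A × B | p.1 ∈ e.source ∧ e p.1 = p.2}, p.2 ∈ e.target) →
    IsClosed {p : A × B | p.1 ∈ e.source ∧ e p.1 = p.2} :=
  fun _ _ _ _ _ e h => CapModel.isClosed_graph_of_closure_subset_target e h

end Summit.SmoothPoincare4.SmoothPoincare4.Theorems.GromovRecognitionRelEnd.CrossCapLaurent
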